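import Literature.GroupTheory.CombinatorialGroupTheory.RibbonGraphEdgeDeletion
import HarnessLib

/-!
# Deleting an edge of a one-vertex ribbon graph: what happens to the boundary cycles

Topic `Literature/GroupTheory/CombinatorialGroupTheory`; continues
`RibbonGraphEdgeDeletion.lean` (notation: rotation `ρ`, deleted edge `e` with darts
`h = (e, true)`, `h̄ = (e, false)`, old face permutation `φ = face ρ`, new one `ψ = delFace ρ e`,
letters `letter`, products along cycles `prodFrom` / `cycleProd`).  Theorems only.

* MERGE (`h`, `h̄` on different boundary cycles, of lengths `p + 1`, `q + 1`): the darts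
  `φ h, …, φ^p h, φ h̄, …, φ^q h̄` form ONE `ψ`-cycle (`merge_minimalPeriod`,
  `merge_sameCycle_iff`) whose word is `U · V`, `U = prodFrom φ letter (φ h) p`,
  `V = prodFrom φ letter (φ h̄) q` (`merge_prodFrom`), while the old words were `e · U` and
  `e⁻¹ · V` (`cycleProd_true_eq`, `cycleProd_false_eq`).
* SPLIT (`h`, `h̄` on the same cycle `h, φ h, …, φ^p h, h̄, φ h̄, …, φ^q h̄`): the darts
  `φ h, …, φ^p h` and `φ h̄, …, φ^q h̄` form TWO `ψ`-cycles with words `U`, `V`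
  (`split_minimalPeriod_true/false`, `split_prodFrom_true/false`, `split_not_sameCycle`), while
  the old word was `e · U · e⁻¹ · V` (`split_cycleProd_eq`).
* OTHERS: boundary cycles avoiding `h`, `h̄` are untouched (`others_eq`).

Classical "cutting a ribbon graph along an edge" (Mohar–Thomassen, *Graphs on Surfaces* (2001)
§3.3; Zieschang–Vogt–Coldewey LNM 835 §3.2).
-/

namespace Literature.GroupTheory.CombinatorialGroupTheory

namespace RibbonGraph

open Equiv Equiv.Perm Function

universe u

variable {E : Type u} [DecidableEq E] [Finite E] (ρ : Perm (Dart E)) (e : E)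

/-! ### Darts of `e` along a boundary cycle -/

omit [DecidableEq E] [Finite E] in
/-- On the boundary cycle of `h = (e, true)` of length `p + 1` not containing `h̄`, the darts
`φ^k h`, `1 ≤ k ≤ p`, are not darts of `e`. [cite: ZieschangVogtColdewey1980, 3.1.6 and 3.2.3] -/
theorem pow_face_true_fst_ne {p : ℕ} (hp : minimalPeriod (face ρ) (e, true) = p + 1)
    (hne : ¬ (face ρ).SameCycle (e, true) (e, false)) {k : ℕ} (hk1 : 1 ≤ k) (hkp : k ≤ p) :
    ((face ρ ^ k) (e, true)).1 ≠ e := by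
  rw [dart_fst_ne_iff]
  refine ⟨pow_apply_ne_of_lt_minimalPeriod _ hk1 (by omega), fun h => hne ?_⟩
  rw [← h]; exact (sameCycle_pow_right (f := face ρ) (n := k)).2 SameCycle.rfl

omit [DecidableEq E] [Finite E] in
/-- Symmetrically for `h̄ = (e, false)`. [cite: ZieschangVogtColdewey1980, 3.1.6 and 3.2.3] -/
theorem pow_face_false_fst_ne {q : ℕ} (hq : minimalPeriod (face ρ) (e, false) = q + 1)
    (hne : ¬ (face ρ).SameCycle (e, true) (e, false)) {k : ℕ} (hk1 : 1 ≤ k) (hkq : k ≤ q) :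
    ((face ρ ^ k) (e, false)).1 ≠ e := by
  rw [dart_fst_ne_iff]
  refine ⟨fun h => hne ?_, pow_apply_ne_of_lt_minimalPeriod _ hk1 (by omega)⟩
  rw [← h]; exact ((sameCycle_pow_right (f := face ρ) (n := k)).2 SameCycle.rfl).symm

omit [DecidableEq E] [Finite E] in
/-- The old boundary word through `h`: `e · U`. [cite: ZieschangVogtColdewey1980, 3.1.6 and 3.2.3] -/
theorem cycleProd_true_eq {p : ℕ} (hp : minimalPeriod (face ρ) (e, true) = p + 1) :
    cycleProd (face ρ) letter (e, true) =
      FreeGroup.of e * prodFrom (face ρ) letter (face ρ (e, true)) p := by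
  rw [cycleProd, hp, prodFrom_succ, letter_true]

omit [DecidableEq E] [Finite E] in
/-- The old boundary word through `h̄`: `e⁻¹ · V`. [cite: ZieschangVogtColdewey1980, 3.1.6 and 3.2.3] -/
theorem cycleProd_false_eq {q : ℕ} (hq : minimalPeriod (face ρ) (e, false) = q + 1) :
    cycleProd (face ρ) letter (e, false) =
      (FreeGroup.of e)⁻¹ * prodFrom (face ρ) letter (face ρ (e, false)) q := by
  rw [cycleProd, hq, prodFrom_succ, letter_false]

/-- `prodFrom` from the successor is an `ofFn`-product of the labels of `φ^(k+1) x`. [cite: ZieschangVogtColdewey1980, 3.1.6 and 3.2.3] -/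
theorem prodFrom_apply_eq_ofFn {α : Type*} {G : Type*} [Monoid G] (σ : Perm α) (ℓ : α → G) (x : α)
    (n : ℕ) : prodFrom σ ℓ (σ x) n = (List.ofFn fun k : Fin n => ℓ ((σ ^ ((k : ℕ) + 1)) x)).prod := by
  have hfun : (fun k : Fin n => ℓ ((σ ^ (k : ℕ)) (σ x))) =
      fun k : Fin n => ℓ ((σ ^ ((k : ℕ) + 1)) x) :=
    funext fun k => by rw [pow_succ, Perm.mul_apply]
  unfold prodFrom
  rw [hfun]

/-! ### MERGE: `h` and `h̄` on different boundary cycles -/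

section Merge

variable {ρ e} {p q : ℕ} (hne : ¬ (face ρ).SameCycle (e, true) (e, false))
  (hp : minimalPeriod (face ρ) (e, true) = p + 1) (hq : minimalPeriod (face ρ) (e, false) = q + 1)

/-- The merged boundary cycle, as a sequence: `φ h, …, φ^p h, φ h̄, …, φ^q h̄`. [cite: ZieschangVogtColdewey1980, 3.1.6 and 3.2.3] -/
def mergeSeq (ρ : Perm (Dart E)) (e : E) (p : ℕ) (k : ℕ) : Dart E :=
  if k < p then (face ρ ^ (k + 1)) (e, true) else (face ρ ^ (k - p + 1)) (e, false)

include hne hp hq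

omit [DecidableEq E] [Finite E] in
/-- `mergeSeq_fst_ne`: bookkeeping lemma of this construction (see the module docstring). [cite: ZieschangVogtColdewey1980, 3.1.6 and 3.2.3] -/
theorem mergeSeq_fst_ne {k : ℕ} (hk : k < p + q) : (mergeSeq ρ e p k).1 ≠ e := by
  unfold mergeSeq
  split_ifs with h
  · exact pow_face_true_fst_ne ρ e hp hne (by omega) (by omega)
  · exact pow_face_false_fst_ne ρ e hq hne (by omega) (by omega)

omit [DecidableEq E] in
/-- `mergeSeq_injOn`: bookkeeping lemma of this construction (see the module docstring). [cite: ZieschangVogtColdewey1980, 3.1.6 and 3.2.3] -/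
theorem mergeSeq_injOn {i j : ℕ} (hi : i < p + q) (hj : j < p + q)
    (h : mergeSeq ρ e p i = mergeSeq ρ e p j) : i = j := by
  unfold mergeSeq at h
  split_ifs at h with h1 h2 h2
  · have := pow_apply_injOn_lt_minimalPeriod (face ρ) (x := (e, true)) (i := i + 1) (j := j + 1)
      (by omega) (by omega) h
    omega
  · exfalso; apply hne
    have h' : (face ρ ^ (i + 1)) (e, true) = (face ρ ^ (j - p + 1)) (e, false) := h
    exact ((sameCycle_pow_right (f := face ρ) (n := i + 1)).2 SameCycle.rfl).trans
      (h' ▸ ((sameCycle_pow_right (f := face ρ) (n := j - p + 1)).2 SameCycle.rfl).symm)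
  · exfalso; apply hne
    have h' : (face ρ ^ (i - p + 1)) (e, false) = (face ρ ^ (j + 1)) (e, true) := h
    exact ((sameCycle_pow_right (f := face ρ) (n := j + 1)).2 SameCycle.rfl).trans
      (h' ▸ ((sameCycle_pow_right (f := face ρ) (n := i - p + 1)).2 SameCycle.rfl)).symm
  · have := pow_apply_injOn_lt_minimalPeriod (face ρ) (x := (e, false)) (i := i - p + 1)
      (j := j - p + 1) (by omega) (by omega) h
    omega

omit [Finite E] in
/-- The new boundary walk steps along the merged sequence. [cite: ZieschangVogtColdewey1980, 3.1.6 and 3.2.3] -/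
theorem delFace_mergeSeq {k : ℕ} (hk : k + 1 < p + q) :
    delFace ρ e (mergeSeq ρ e p k) = mergeSeq ρ e p (k + 1) := by
  have hk0 := mergeSeq_fst_ne hne hp hq (k := k) (by omega)
  by_cases hkp : k + 1 < p
  · -- inside `P`
    have e1 : mergeSeq ρ e p k = (face ρ ^ (k + 1)) (e, true) := by simp [mergeSeq, show k < p by omega]
    have e2 : mergeSeq ρ e p (k + 1) = (face ρ ^ (k + 2)) (e, true) := by simp [mergeSeq, hkp]
    have e3 : face ρ (mergeSeq ρ e p k) = mergeSeq ρ e p (k + 1) := by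
      rw [e1, e2, ← Perm.mul_apply, ← pow_succ']
    rw [← e3]
    refine delFace_apply_of_face_fst_ne ρ e hk0 ?_
    rw [e3]; exact mergeSeq_fst_ne hne hp hq (by omega)
  by_cases hkp' : k + 1 = p
  · -- last dart of `P`: jump to the first dart of `Q` (here `q ≥ 1`)
    have e1 : mergeSeq ρ e p k = (face ρ ^ p) (e, true) := by
      simp [mergeSeq, show k < p by omega, hkp']
    have e2 : mergeSeq ρ e p (k + 1) = face ρ (e, false) := by simp [mergeSeq, hkp']
    have e3 : face ρ (mergeSeq ρ e p k) = (e, true) := by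
      rw [e1, ← Perm.mul_apply, ← pow_succ', ← hp]; exact pow_minimalPeriod_perm _ _
    have hfb : face ρ (e, false) ≠ (e, false) := by
      simpa using pow_apply_ne_of_lt_minimalPeriod (face ρ) (x := (e, false)) (k := 1) Nat.one_pos (by omega)
    rw [e2]; exact (delFace_apply_of_face_eq_true ρ e hk0 e3).1 hfb
  · -- inside `Q`
    have e1 : mergeSeq ρ e p k = (face ρ ^ (k - p + 1)) (e, false) := by
      simp [mergeSeq, show ¬ k < p by omega]
    have e2 : mergeSeq ρ e p (k + 1) = (face ρ ^ (k - p + 2)) (e, false) := by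
      simp [mergeSeq, show ¬ (k + 1) < p by omega, show k + 1 - p + 1 = k - p + 2 by omega]
    have e3 : face ρ (mergeSeq ρ e p k) = mergeSeq ρ e p (k + 1) := by
      rw [e1, e2, ← Perm.mul_apply, ← pow_succ']
    rw [← e3]
    refine delFace_apply_of_face_fst_ne ρ e hk0 ?_
    rw [e3]; exact mergeSeq_fst_ne hne hp hq (by omega)

omit [Finite E] in
/-- … and wraps around. [cite: ZieschangVogtColdewey1980, 3.1.6 and 3.2.3] -/
theorem delFace_mergeSeq_last (hpq : 0 < p + q) :
    delFace ρ e (mergeSeq ρ e p (p + q - 1)) = mergeSeq ρ e p 0 := by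
  have hk0 := mergeSeq_fst_ne hne hp hq (k := p + q - 1) (by omega)
  rcases Nat.eq_zero_or_pos q with hq0 | hq1
  · -- `q = 0`: `h̄` is a boundary cycle by itself; the last dart of `P` returns to `φ h`
    subst hq0
    have e1 : mergeSeq ρ e p (p + 0 - 1) = (face ρ ^ p) (e, true) := by
      rw [mergeSeq, if_pos (by omega), show p + 0 - 1 + 1 = p by omega]
    have e2 : mergeSeq ρ e p 0 = face ρ (e, true) := by simp [mergeSeq, show 0 < p by omega]
    have e3 : face ρ (mergeSeq ρ e p (p + 0 - 1)) = (e, true) := by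
      rw [e1, ← Perm.mul_apply, ← pow_succ', ← hp]; exact pow_minimalPeriod_perm _ _
    have hfb : face ρ (e, false) = (e, false) := by
      have := pow_minimalPeriod_perm (face ρ) (e, false)
      rwa [hq, zero_add, pow_one] at this
    rw [e2]; exact (delFace_apply_of_face_eq_true ρ e hk0 e3).2 hfb
  · have e1 : mergeSeq ρ e p (p + q - 1) = (face ρ ^ q) (e, false) := by
      simp [mergeSeq, show ¬ p + q - 1 < p by omega, show p + q - 1 - p + 1 = q by omega]
    have e3 : face ρ (mergeSeq ρ e p (p + q - 1)) = (e, false) := by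
      rw [e1, ← Perm.mul_apply, ← pow_succ', ← hq]; exact pow_minimalPeriod_perm _ _
    rcases Nat.eq_zero_or_pos p with hp0 | hp1
    · subst hp0
      have e2 : mergeSeq ρ e 0 0 = face ρ (e, false) := by simp [mergeSeq]
      have hft : face ρ (e, true) = (e, true) := by
        have := pow_minimalPeriod_perm (face ρ) (e, true)
        rwa [hp, zero_add, pow_one] at this
      rw [e2]; exact (delFace_apply_of_face_eq_false ρ e hk0 e3).2 hft
    · have e2 : mergeSeq ρ e p 0 = face ρ (e, true) := by simp [mergeSeq, hp1]
      have hft : face ρ (e, true) ≠ (e, true) := by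
        simpa using pow_apply_ne_of_lt_minimalPeriod (face ρ) (x := (e, true)) (k := 1) Nat.one_pos (by omega)
      rw [e2]; exact (delFace_apply_of_face_eq_false ρ e hk0 e3).1 hft

/-- MERGE: the merged boundary cycle of `ψ` has length `p + q`. [cite: ZieschangVogtColdewey1980, 3.1.6 and 3.2.3] -/
theorem merge_minimalPeriod (hpq : 0 < p + q) :
    minimalPeriod (delFace ρ e) (mergeSeq ρ e p 0) = p + q :=
  minimalPeriod_eq_of_cyclicSeq (delFace ρ e) (mergeSeq ρ e p) hpq
    (fun _ hk => delFace_mergeSeq hne hp hq hk) (delFace_mergeSeq_last hne hp hq hpq)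
    (fun _ _ hi hj h => mergeSeq_injOn hne hp hq hi hj h)

omit [Finite E] in
/-- MERGE: its word is `U · V`. [cite: ZieschangVogtColdewey1980, 3.1.6 and 3.2.3] -/
theorem merge_prodFrom :
    prodFrom (delFace ρ e) letter (mergeSeq ρ e p 0) (p + q) =
      prodFrom (face ρ) letter (face ρ (e, true)) p * prodFrom (face ρ) letter (face ρ (e, false)) q := by
  rw [prodFrom_eq_of_seq (delFace ρ e) letter (mergeSeq ρ e p) (fun _ hk => delFace_mergeSeq hne hp hq hk),
    List.ofFn_add, List.prod_append, prodFrom_apply_eq_ofFn, prodFrom_apply_eq_ofFn]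
  congr 2
  · exact List.ofFn_inj.mpr (funext fun k => by simp [mergeSeq])
  · exact List.ofFn_inj.mpr (funext fun k => by simp [mergeSeq])

/-- MERGE: the merged cycle consists of the old cycles of `h` and `h̄` minus `h`, `h̄`. [cite: ZieschangVogtColdewey1980, 3.1.6 and 3.2.3] -/
theorem merge_sameCycle_iff (hpq : 0 < p + q) (y : Dart E) :
    (delFace ρ e).SameCycle (mergeSeq ρ e p 0) y ↔
      (y ≠ (e, true) ∧ (face ρ).SameCycle (e, true) y) ∨
        (y ≠ (e, false) ∧ (face ρ).SameCycle (e, false) y) := by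
  rw [sameCycle_iff_of_cyclicSeq (delFace ρ e) (mergeSeq ρ e p) hpq
    (fun _ hk => delFace_mergeSeq hne hp hq hk) (delFace_mergeSeq_last hne hp hq hpq)
    (fun _ _ hi hj h => mergeSeq_injOn hne hp hq hi hj h)]
  constructor
  · rintro ⟨k, hk, rfl⟩
    unfold mergeSeq
    split_ifs with hkp
    · exact Or.inl ⟨pow_apply_ne_of_lt_minimalPeriod _ (by omega) (by omega),
        (sameCycle_pow_right (f := face ρ) (n := k + 1)).2 SameCycle.rfl⟩
    · exact Or.inr ⟨pow_apply_ne_of_lt_minimalPeriod _ (by omega) (by omega),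
        (sameCycle_pow_right (f := face ρ) (n := k - p + 1)).2 SameCycle.rfl⟩
  · rintro (⟨hy, hs⟩ | ⟨hy, hs⟩)
    · obtain ⟨j, hj, rfl⟩ := exists_lt_minimalPeriod_of_sameCycle _ hs
      have hj0 : j ≠ 0 := by rintro rfl; exact hy (by simp)
      refine ⟨j - 1, by omega, ?_⟩
      rw [mergeSeq, if_pos (show j - 1 < p by omega), show j - 1 + 1 = j by omega]
    · obtain ⟨j, hj, rfl⟩ := exists_lt_minimalPeriod_of_sameCycle _ hs
      have hj0 : j ≠ 0 := by rintro rfl; exact hy (by simp)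
      refine ⟨p + (j - 1), by omega, ?_⟩
      rw [mergeSeq, if_neg (show ¬ p + (j - 1) < p by omega), show p + (j - 1) - p + 1 = j by omega]


omit [Finite E] in
/-- MERGE: the first `p` letters of the merged word form `U`. [cite: ZieschangVogtColdewey1980, 3.1.6 and 3.2.3] -/
theorem merge_prodFrom_fst :
    prodFrom (delFace ρ e) letter (mergeSeq ρ e p 0) p = prodFrom (face ρ) letter (face ρ (e, true)) p := by
  have h := prodFrom_eq_of_seq (delFace ρ e) letter (mergeSeq ρ e p) (N := p)
    (fun k hk => delFace_mergeSeq hne hp hq (by omega))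
  rw [h, prodFrom_apply_eq_ofFn]
  congr 1
  exact List.ofFn_inj.mpr (funext fun k => by simp [mergeSeq])

omit [DecidableEq E] [Finite E] in
/-- `mergeSeq_zero_fst_ne`: bookkeeping lemma of this construction (see the module docstring). [cite: ZieschangVogtColdewey1980, 3.1.6 and 3.2.3] -/
theorem mergeSeq_zero_fst_ne (hpq : 0 < p + q) : (mergeSeq ρ e p 0).1 ≠ e :=
  mergeSeq_fst_ne hne hp hq hpq

end Merge


/-! ### OTHERS: boundary cycles avoiding the deleted edge -/

/-- Boundary cycles through neither dart of `e` are unchanged by deleting `e`: same darts, same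
length, same word. [cite: ZieschangVogtColdewey1980, 3.1.6 and 3.2.3] -/
theorem others_eq {ρ : Perm (Dart E)} {e : E} {y : Dart E}
    (h1 : ¬ (face ρ).SameCycle (e, true) y) (h2 : ¬ (face ρ).SameCycle (e, false) y) :
    minimalPeriod (delFace ρ e) y = minimalPeriod (face ρ) y ∧
      cycleProd (delFace ρ e) letter y = cycleProd (face ρ) letter y ∧
        ∀ z, ((delFace ρ e).SameCycle y z ↔ (face ρ).SameCycle y z) := by
  refine cycleProd_congr_perm (face ρ) (delFace ρ e) letter fun z hz => ?_
  have hz1 : z.1 ≠ e := by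
    rw [dart_fst_ne_iff]
    exact ⟨fun h => h1 (h ▸ hz).symm, fun h => h2 (h ▸ hz).symm⟩
  have hz2 : (face ρ z).1 ≠ e := by
    have hz' : (face ρ).SameCycle y (face ρ z) := hz.trans (SameCycle.rfl.apply_right)
    rw [dart_fst_ne_iff]
    exact ⟨fun h => h1 (h ▸ hz').symm, fun h => h2 (h ▸ hz').symm⟩
  exact delFace_apply_of_face_fst_ne ρ e hz1 hz2

end RibbonGraph

end Literature.GroupTheory.CombinatorialGroupTheory
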